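import Literature.AlgebraicGeometry.ShimuraVarieties.KudlaRapoport2013.Sec13LevelStructures
import Mathlib.Algebra.Squarefree.Basic
import Mathlib.RingTheory.Noetherian.Basic
import Mathlib.RingTheory.Coprime.Lemmas
import HarnessLib

/-!
# [KudlaRapoport2013, §13.1 after Def. 13.2 (arXiv v2 p. 49)] «for any `O_k`-module of type `t`, the hermitian space `V = L ⊗ ℚ` is relevant»
# — DISCHARGED: `KR2013_13_2_relevant_holds`

Kernel-lane companion of the statement carpet ★ `Literature/AlgebraicGeometry/ShimuraVarieties/KudlaRapoport2013/Sec13LevelStructures.lean`: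
its CLOSED named fact ★ `KR2013_13_2_relevant` is PROVED here.  THEOREMS ONLY (no definition, no named fact, no `sorry`, no instance, no
notation); cell hodgecm-mathlib, seat B-typ01 (g33); net debt −1.

## The argument

KR prove the sentence by the local–global principle for hermitian lattices («it suffices to check this locally at any inert prime `p`. But
for such `p` a self-dual lattice in `V_p` is given by `L ⊗ ℤ_p = L^∨ ⊗ ℤ_p`»).  The tree has no genus theory for hermitian lattices, so we
give the direct global argument, which is also shorter (a deviation of road, not of statement):

1. *`(x, x) ∈ O_k` for every `x ∈ L^∨`.*  Let `𝔡 = ⋂_{p ∣ Δ} 𝔭_p`.  Since `L^∨/L ≃ ∏_p (O_k/𝔭_p)^{t(p)}` is killed by `𝔡`, `a x ∈ L` for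
   `a ∈ 𝔡`, so `a (x, x) = σ((x, a x)) ∈ O_k`; hence `z (x, x)² ∈ O_k` for `z ∈ 𝔡²`, in particular for `z = D₀ = ∏_{p ∣ Δ} p`
   (`𝔭_p² = (p)`).  But `(x, x) = q₀ ∈ ℚ` is `σ`-fixed and `D₀` is squarefree, so `D₀ q₀² ∈ ℤ` forces `q₀ ∈ ℤ`.
2. *A maximal integral over-lattice.*  `L ⊆ L^∨ ⊆ Δ⁻¹L`, and `Δ⁻¹L` is finitely generated, hence a Noetherian `O_k`-module; the family of
   `O_k`-modules `L ⊆ Q ⊆ L^∨` with `(Q, Q) ⊆ O_k` contains `L` and therefore has a maximal member `Λ`.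
3. *`Λ` is self-dual.*  `Λ` is a full lattice (finitely generated, contains `L`).  If `(x, Λ) ⊆ O_k` then `(x, L) ⊆ O_k`, i.e. `x ∈ L^∨`,
   and `Λ + O_k x` is again integral (by 1. for `(x, x)` and by hermitian symmetry for `(Λ, x)`), so `x ∈ Λ` by maximality.

The parity / size conditions on `t` are not needed.

## References
* [KudlaRapoport2013] S. Kudla, M. Rapoport, *Special cycles on unitary Shimura varieties II: global theory*, J. reine angew. Math. 697
  (2014) 91–157 = arXiv:0912.3758v2, §13.1 Definition 13.2 and the sentence after it (p. 49).
* [Omeara1963] O. T. O'Meara, *Introduction to quadratic forms* (1963), §82F (dual lattices, maximal lattices: §82:18–§82:19).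
-/

set_option autoImplicit false

noncomputable section

open NumberField
open Literature.NumberTheory.Automorphic.Liu2021.AppendixC (conj)
open Literature.AlgebraicGeometry.ShimuraVarieties.KudlaRapoport2013.Sec2Defs (sigmaInt)
open Literature.AlgebraicGeometry.ShimuraVarieties.KudlaRapoport2013.Sec3ComplexUniformization
  (krForm IsHermitianFor IsFullLattice IsSelfDualFor LatticeDatum)
open scoped Matrix

namespace Literature.AlgebraicGeometry.ShimuraVarieties.KudlaRapoport2013.Sec13LevelStructures

/-! ### The hermitian pairing `(x, y) = σ(y)ᵀ J x` (★ `krForm`): sesquilinearity and symmetry -/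

section KrForm

variable {k : Type} [Field k] [NumberField k] [IsTotallyComplex k] [Algebra.IsQuadraticExtension ℚ k]
variable {n : ℕ} (J : Matrix (Fin n) (Fin n) k)

/-- Additivity of `(x, y)` in `x`. [folklore] -/
private theorem krForm_add_left (x x' y : Fin n → k) :
    krForm (conj ℚ k : k →+* k) J (x + x') y = krForm (conj ℚ k : k →+* k) J x y + krForm (conj ℚ k : k →+* k) J x' y := by
  simp [krForm, Matrix.mulVec_add, dotProduct_add]

/-- `k`-linearity of `(x, y)` in `x`. [folklore] -/
private theorem krForm_smul_left (c : k) (x y : Fin n → k) :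
    krForm (conj ℚ k : k →+* k) J (c • x) y = c * krForm (conj ℚ k : k →+* k) J x y := by
  simp [krForm, Matrix.mulVec_smul, dotProduct_smul]

/-- Additivity of `(x, y)` in `y`. [folklore] -/
private theorem krForm_add_right (x y y' : Fin n → k) :
    krForm (conj ℚ k : k →+* k) J x (y + y') = krForm (conj ℚ k : k →+* k) J x y + krForm (conj ℚ k : k →+* k) J x y' := by
  have h : (⇑(conj ℚ k : k →+* k) ∘ (y + y')) = (⇑(conj ℚ k : k →+* k) ∘ y) + (⇑(conj ℚ k : k →+* k) ∘ y') := by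
    funext i; simp
  rw [krForm, krForm, krForm, h, add_dotProduct]

/-- `σ`-antilinearity of `(x, y)` in `y`. [folklore] -/
private theorem krForm_smul_right (c : k) (x y : Fin n → k) :
    krForm (conj ℚ k : k →+* k) J x (c • y) = conj ℚ k c * krForm (conj ℚ k : k →+* k) J x y := by
  have h : (⇑(conj ℚ k : k →+* k) ∘ (c • y)) = conj ℚ k c • (⇑(conj ℚ k : k →+* k) ∘ y) := by
    funext i; simp
  rw [krForm, krForm, h, smul_dotProduct, smul_eq_mul]

/-- `σ` is an involution of `k`. [folklore] -/
private theorem conj_conj' (x : k) : conj ℚ k (conj ℚ k x) = x := by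
  letI : IsCMField k := IsCMField.ofCMExtension ℚ k
  exact IsCMField.complexConj_apply_apply (K := k) x

/-- `σ(O_k) ⊆ O_k` (`σ` restricts to ★ `sigmaInt` on `O_k`). [folklore] -/
private theorem conj_mem_range {r : k} (hr : r ∈ (algebraMap (𝓞 k) k).range) :
    conj ℚ k r ∈ (algebraMap (𝓞 k) k).range := by
  obtain ⟨b, rfl⟩ := hr
  exact ⟨sigmaInt k b, rfl⟩

/-- **Hermitian symmetry of the pairing**: `σ((x, y)) = (y, x)` when `σ(J_{ab}) = J_{ba}`. [folklore] -/
private theorem conj_krForm (hJ : IsHermitianFor (conj ℚ k : k →+* k) J) (x y : Fin n → k) :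
    conj ℚ k (krForm (conj ℚ k : k →+* k) J x y) = krForm (conj ℚ k : k →+* k) J y x := by
  have hJ' : ∀ i j, conj ℚ k (J i j) = J j i := hJ
  simp only [krForm, dotProduct, Matrix.mulVec, Function.comp_apply, RingHom.coe_coe, map_sum, map_mul, Finset.mul_sum]
  rw [Finset.sum_comm]
  refine Finset.sum_congr rfl fun a _ => Finset.sum_congr rfl fun b _ => ?_
  rw [conj_conj', hJ']
  ring

end KrForm

/-! ### Rational numbers: `σ`-fixed elements, and `D q² ∈ ℤ` with `D` squarefree forces `q ∈ ℤ` -/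

section Rational

variable {k : Type} [Field k] [NumberField k] [IsTotallyComplex k] [Algebra.IsQuadraticExtension ℚ k]

/-- An element of `k` fixed by `σ` is rational. [folklore] -/
private theorem exists_rat_eq_of_conj_eq' {x : k} (hx : conj ℚ k x = x) : ∃ q : ℚ, algebraMap ℚ k q = x := by
  letI : IsCMField k := IsCMField.ofCMExtension ℚ k
  have hx' : IsCMField.complexConj k x = x := hx
  have hmem : x ∈ maximalRealSubfield k := (IsCMField.complexConj_eq_self_iff (K := k) x).1 hx'
  exact ⟨(CMExtension.equivMaximalRealSubfield ℚ k).symm ⟨x, hmem⟩, by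
    rw [CMExtension.algebraMap_equivMaximalRealSubfield_symm_apply]; rfl⟩

omit [NumberField k] [IsTotallyComplex k] [Algebra.IsQuadraticExtension ℚ k] in
/-- A rational number `q` with `D q² ∈ ℤ` for a squarefree natural number `D` is an integer. [folklore] -/
private theorem exists_int_cast_eq_of_squarefree {D : ℕ} (hD : Squarefree D) {q : ℚ} {m : ℤ}
    (h : (D : ℚ) * q * q = m) : ∃ z : ℤ, (z : ℚ) = q := by
  have hnum : (D : ℤ) * (q.num * q.num) = (q.den : ℤ) * q.den * m := by
    have h1 : (((D : ℤ) * (q.num * q.num) : ℤ) : ℚ) = (((q.den : ℤ) * q.den * m : ℤ) : ℚ) := by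
      push_cast
      rw [← Rat.mul_den_eq_num, ← h]
      ring
    exact_mod_cast h1
  have hcop : IsCoprime (q.den : ℤ) q.num := by
    rw [Int.isCoprime_iff_gcd_eq_one, Int.gcd_eq_natAbs, Int.natAbs_natCast, Nat.gcd_comm]
    exact q.reduced
  have hdvd : (q.den : ℤ) * q.den ∣ (D : ℤ) :=
    ((hcop.mul_left hcop).mul_right (hcop.mul_left hcop)).dvd_of_dvd_mul_right ⟨m, by rw [hnum]⟩
  have hden : q.den = 1 := Nat.isUnit_iff.1 (Int.ofNat_isUnit.1 (Int.squarefree_natCast.2 hD _ hdvd))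
  exact ⟨q.num, Rat.coe_int_num_of_den_eq_one hden⟩

/-- A `σ`-fixed `q ∈ k` with `D q² ∈ O_k` for a squarefree natural number `D` lies in `O_k` (indeed in `ℤ`). [folklore] -/
private theorem mem_range_of_squarefree_mul_self {D : ℕ} (hD : Squarefree D) {q : k} (hq : conj ℚ k q = q)
    (hDq : (D : k) * q * q ∈ (algebraMap (𝓞 k) k).range) : q ∈ (algebraMap (𝓞 k) k).range := by
  obtain ⟨q₀, rfl⟩ := exists_rat_eq_of_conj_eq' hq
  obtain ⟨b, hb⟩ := hDq
  have hint : IsIntegral ℤ ((D : ℚ) * q₀ * q₀) := by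
    have h : IsIntegral ℤ (algebraMap ℚ k ((D : ℚ) * q₀ * q₀)) := by
      rw [map_mul, map_mul, map_natCast, ← hb]
      exact RingOfIntegers.isIntegral_coe b
    exact (isIntegral_algebraMap_iff (algebraMap ℚ k).injective).1 h
  obtain ⟨m, hm⟩ := (IsIntegrallyClosed.isIntegral_iff (R := ℤ) (K := ℚ)).1 hint
  obtain ⟨z, hz⟩ := exists_int_cast_eq_of_squarefree hD (m := m) (by rw [← hm]; simp)
  refine ⟨(z : 𝓞 k), ?_⟩
  rw [← hz, map_intCast, map_intCast]

end Rational

/-! ### Step 1: `(x, x) ∈ O_k` on the dual of a lattice of type `t` -/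

section Integrality

variable {k : Type} [Field k] [NumberField k] [IsTotallyComplex k] [Algebra.IsQuadraticExtension ℚ k]
variable {n : ℕ}

/-- **Integrality of `(x, x)` on `L^∨`** for a hermitian lattice `L ⊆ L^∨` with `L^∨/L ≃ ∏_{p ∣ Δ} (O_k/𝔭_p)^{t(p)}`, `𝔭_p² = (p)`:
`𝔡 = ⋂ 𝔭_p` kills `L^∨/L`, so `𝔡 · (x, x) ⊆ O_k`, `𝔡² ∋ ∏_{p∣Δ} p =: D₀` squarefree, `D₀ (x, x)² ∈ ℤ` with `(x, x) ∈ ℚ`, whence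
`(x, x) ∈ ℤ`. [folklore] -/
private theorem krForm_self_mem_range (X : LatticeDatum k n) (hJ : IsHermitianFor (conj ℚ k : k →+* k) X.J)
    {L' : Submodule (𝓞 k) (Fin n → k)} {𝔭 : ℕ → Ideal (𝓞 k)} {t : ℕ → ℕ}
    (hL'set : (L' : Set (Fin n → k)) = dualSet (conj ℚ k : k →+* k) X.J X.L)
    (h𝔭 : ∀ p ∈ (absDisc k).primeFactors, (𝔭 p).IsPrime ∧ 𝔭 p ^ 2 = Ideal.span {((p : ℤ) : 𝓞 k)})
    (φ : (L' ⧸ X.L.comap L'.subtype) ≃ₗ[𝓞 k] ((p : (absDisc k).primeFactors) → Fin (t p) → 𝓞 k ⧸ 𝔭 p))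
    {x : Fin n → k} (hx : x ∈ L') :
    krForm (conj ℚ k : k →+* k) X.J x x ∈ (algebraMap (𝓞 k) k).range := by
  classical
  have hdual : ∀ y ∈ X.L, krForm (conj ℚ k : k →+* k) X.J x y ∈ (algebraMap (𝓞 k) k).range := by
    have h : x ∈ (L' : Set (Fin n → k)) := hx
    rw [hL'set] at h
    exact h
  -- (a) `𝔡 = ⋂ 𝔭_p` multiplies `L^∨` into `L`
  have hann : ∀ a : 𝓞 k, (∀ p ∈ (absDisc k).primeFactors, a ∈ 𝔭 p) → a • x ∈ X.L := by
    intro a ha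
    have h0 : a • φ (Submodule.Quotient.mk (p := X.L.comap L'.subtype) ⟨x, hx⟩) = 0 := by
      funext p i
      obtain ⟨b, hb⟩ := Ideal.Quotient.mk_surjective (φ (Submodule.Quotient.mk (p := X.L.comap L'.subtype) ⟨x, hx⟩) p i)
      rw [Pi.smul_apply, Pi.smul_apply, Pi.zero_apply, Pi.zero_apply, ← hb, ← Ideal.Quotient.mk_eq_mk,
        ← Submodule.Quotient.mk_smul, Submodule.Quotient.mk_eq_zero, smul_eq_mul]
      exact (𝔭 p).mul_mem_right b (ha p p.2)
    have h1 : φ (a • Submodule.Quotient.mk (p := X.L.comap L'.subtype) ⟨x, hx⟩) = 0 := by rw [map_smul, h0]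
    rw [LinearEquiv.map_eq_zero_iff, ← Submodule.Quotient.mk_smul, Submodule.Quotient.mk_eq_zero,
      Submodule.mem_comap] at h1
    exact h1
  -- (b) `a (x, x) ∈ O_k` for `a ∈ 𝔡`
  have hfix : conj ℚ k (krForm (conj ℚ k : k →+* k) X.J x x) = krForm (conj ℚ k : k →+* k) X.J x x := conj_krForm X.J hJ x x
  have hmul : ∀ a ∈ (absDisc k).primeFactors.inf 𝔭,
      (a : k) * krForm (conj ℚ k : k →+* k) X.J x x ∈ (algebraMap (𝓞 k) k).range := by
    intro a ha
    have h := hdual (a • x) (hann a (Submodule.mem_finsetInf.1 ha))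
    rw [show (a • x : Fin n → k) = (a : k) • x from rfl, krForm_smul_right] at h
    have h' := conj_mem_range h
    rwa [map_mul, conj_conj', hfix] at h'
  -- (c) `z (x, x)² ∈ O_k` for `z ∈ 𝔡²`
  have hsq : ∀ z ∈ (absDisc k).primeFactors.inf 𝔭 * (absDisc k).primeFactors.inf 𝔭,
      (z : k) * krForm (conj ℚ k : k →+* k) X.J x x * krForm (conj ℚ k : k →+* k) X.J x x ∈ (algebraMap (𝓞 k) k).range := by
    intro z hz
    refine Submodule.mul_induction_on hz (fun a ha b hb => ?_) (fun y y' hy hy' => ?_)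
    · have : ((a * b : 𝓞 k) : k) * krForm (conj ℚ k : k →+* k) X.J x x * krForm (conj ℚ k : k →+* k) X.J x x =
          ((a : k) * krForm (conj ℚ k : k →+* k) X.J x x) * ((b : k) * krForm (conj ℚ k : k →+* k) X.J x x) := by
        push_cast; ring
      rw [this]
      exact mul_mem (hmul a ha) (hmul b hb)
    · push_cast
      rw [add_mul, add_mul]
      exact add_mem hy hy'
  -- (d) `D₀ = ∏_{p ∣ Δ} p ∈ 𝔡²`
  have hD₀mem : (((∏ p ∈ (absDisc k).primeFactors, p : ℕ) : ℤ) : 𝓞 k) ∈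
      (absDisc k).primeFactors.inf 𝔭 * (absDisc k).primeFactors.inf 𝔭 := by
    refine Ideal.mul_mono Ideal.prod_le_inf Ideal.prod_le_inf ?_
    rw [← Finset.prod_mul_distrib, Nat.cast_prod, Int.cast_prod]
    have hprod : ∏ p ∈ (absDisc k).primeFactors, 𝔭 p * 𝔭 p = ∏ p ∈ (absDisc k).primeFactors, Ideal.span {((p : ℤ) : 𝓞 k)} :=
      Finset.prod_congr rfl fun p hp => by rw [← sq, (h𝔭 p hp).2]
    rw [hprod, Ideal.prod_span_singleton]
    exact Ideal.mem_span_singleton_self _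
  -- (e) `D₀` is squarefree, `(x, x)` is rational: conclude
  have hD₀ : Squarefree (∏ p ∈ (absDisc k).primeFactors, p : ℕ) := by
    refine Finset.squarefree_prod_of_pairwise_isCoprime (fun p hp q hq hpq => ?_)
      fun p hp => (Nat.prime_of_mem_primeFactors hp).prime.squarefree
    exact Nat.coprime_iff_isRelPrime.1
      ((Nat.coprime_primes (Nat.prime_of_mem_primeFactors hp) (Nat.prime_of_mem_primeFactors hq)).2 hpq)
  refine mem_range_of_squarefree_mul_self hD₀ hfix ?_
  have h := hsq _ hD₀mem
  simpa only [RingOfIntegers.coe_eq_algebraMap, map_intCast, map_natCast, Int.cast_natCast] using h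

end Integrality

/-! ### The discharge -/

/-- ★ `KR2013_13_2_relevant` HOLDS. [KudlaRapoport2013, §13.1 after Def. 13.2 (arXiv v2 p. 49)]: «for any `O_k`-module of type `t`, the hermitian
space `V = L ⊗ ℚ` is relevant» — a hermitian full lattice `L` with `L ⊆ L^∨ ⊆ Δ⁻¹L`, `L^∨/L ≃ ∏_{p∣Δ} (O_k/𝔭_p)^{t(p)}` admits a self-dual full
lattice in `V`: a maximal integral `O_k`-module between `L` and `L^∨` (Noetherian induction inside `Δ⁻¹L`) is self-dual, using `(x, x) ∈ O_k` on `L^∨`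
(KR argue instead through the local–global principle at an inert prime). [cite: KudlaRapoport2013, §13.1 (arXiv v2 p. 49)] -/
theorem KR2013_13_2_relevant_holds : KR2013_13_2_relevant := by
  intro k _ _ _ _ n t _ X hJ hL hT
  classical
  obtain ⟨hLL', hΔ, L', 𝔭, hL'set, h𝔭, ⟨φ⟩⟩ := hT
  have hXL' : X.L ≤ L' := fun x hx => by
    have h : x ∈ (L' : Set (Fin n → k)) := by rw [hL'set]; exact hLL' x hx
    exact h
  have hself : ∀ x ∈ L', krForm (conj ℚ k : k →+* k) X.J x x ∈ (algebraMap (𝓞 k) k).range :=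
    fun x hx => krForm_self_mem_range X hJ hL'set h𝔭 φ hx
  -- the ambient finitely generated module `L₁ = Δ⁻¹ L ⊇ L^∨`
  have hD : ((absDisc k : ℚ) : k) ≠ 0 := by
    rw [Rat.cast_natCast]
    exact_mod_cast Int.natAbs_ne_zero.2 (NumberField.discr_ne_zero k)
  obtain ⟨ψ, hψ⟩ : ∃ ψ : (Fin n → k) →ₗ[𝓞 k] (Fin n → k), ∀ x, ψ x = ((absDisc k : ℚ) : k)⁻¹ • x :=
    ⟨⟨⟨fun x => ((absDisc k : ℚ) : k)⁻¹ • x, fun x y => smul_add _ _ _⟩, fun a x => by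
        show ((absDisc k : ℚ) : k)⁻¹ • ((a : k) • x) = (a : k) • (((absDisc k : ℚ) : k)⁻¹ • x)
        exact smul_comm _ _ _⟩, fun _ => rfl⟩
  obtain ⟨L₁, hL'L₁, hL₁⟩ : ∃ L₁ : Submodule (𝓞 k) (Fin n → k), L' ≤ L₁ ∧ L₁.FG := by
    refine ⟨X.L.map ψ, fun x hx => ?_, hL.1.map ψ⟩
    have hx' : x ∈ (L' : Set (Fin n → k)) := hx
    rw [hL'set] at hx'
    refine ⟨((absDisc k : ℚ) : k) • x, hΔ x hx', ?_⟩
    rw [hψ, smul_smul, inv_mul_cancel₀ hD, one_smul]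
  haveI : IsNoetherian (𝓞 k) L₁ := isNoetherian_of_fg_of_noetherian _ hL₁
  -- a maximal integral `O_k`-module `L ⊆ Λ ⊆ L^∨`
  obtain ⟨Q, ⟨hLQ, hQL', hQiso⟩, hQmax⟩ := (set_has_maximal_iff_noetherian.2 ‹IsNoetherian (𝓞 k) L₁›)
    {Q : Submodule (𝓞 k) L₁ | X.L ≤ Q.map L₁.subtype ∧ Q.map L₁.subtype ≤ L' ∧
      ∀ u ∈ Q.map L₁.subtype, ∀ v ∈ Q.map L₁.subtype, krForm (conj ℚ k : k →+* k) X.J u v ∈ (algebraMap (𝓞 k) k).range}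
    (by
      refine ⟨X.L.comap L₁.subtype, ?_⟩
      have heq : (X.L.comap L₁.subtype).map L₁.subtype = X.L := by
        rw [Submodule.map_comap_subtype, inf_eq_right.2 (hXL'.trans hL'L₁)]
      refine ⟨heq.ge, heq.le.trans hXL', fun u hu v hv => ?_⟩
      rw [heq] at hu hv
      exact hLL' u hu v hv)
  refine ⟨Q.map L₁.subtype, ⟨(IsNoetherian.noetherian Q).map _, ?_⟩, fun x => ⟨fun hx y hy => hQiso x hx y hy, fun hx => ?_⟩⟩
  · -- `Λ` spans `V`
    rw [eq_top_iff, ← hL.2]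
    exact Submodule.span_mono fun y hy => hLQ hy
  · -- `Λ^∨ ⊆ Λ`: enlarge `Λ` by `x` and use maximality
    have hxL' : x ∈ L' := by
      have h : x ∈ (L' : Set (Fin n → k)) := by rw [hL'set]; exact fun y hy => hx y (hLQ hy)
      exact h
    set x₁ : L₁ := ⟨x, hL'L₁ hxL'⟩ with hx₁
    have hmem : Q ⊔ (𝓞 k) ∙ x₁ ∈ {Q : Submodule (𝓞 k) L₁ | X.L ≤ Q.map L₁.subtype ∧ Q.map L₁.subtype ≤ L' ∧
        ∀ u ∈ Q.map L₁.subtype, ∀ v ∈ Q.map L₁.subtype,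
          krForm (conj ℚ k : k →+* k) X.J u v ∈ (algebraMap (𝓞 k) k).range} := by
      refine ⟨hLQ.trans (Submodule.map_mono le_sup_left), ?_, ?_⟩
      · rw [Submodule.map_le_iff_le_comap]
        refine sup_le (Submodule.map_le_iff_le_comap.1 hQL') ?_
        rw [Submodule.span_singleton_le_iff_mem, Submodule.mem_comap]
        exact hxL'
      · have hdec : ∀ u ∈ (Q ⊔ (𝓞 k) ∙ x₁).map L₁.subtype,
            ∃ u₀ ∈ Q.map L₁.subtype, ∃ a : 𝓞 k, u = u₀ + (a : k) • x := by
          intro u hu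
          obtain ⟨w, hw, rfl⟩ := hu
          obtain ⟨y, hy, z, hz, rfl⟩ := Submodule.mem_sup.1 hw
          obtain ⟨a, rfl⟩ := Submodule.mem_span_singleton.1 hz
          exact ⟨(y : Fin n → k), ⟨y, hy, rfl⟩, a, rfl⟩
        intro u hu v hv
        obtain ⟨u₀, hu₀, a, rfl⟩ := hdec u hu
        obtain ⟨v₀, hv₀, b, rfl⟩ := hdec v hv
        have h2 : krForm (conj ℚ k : k →+* k) X.J u₀ x ∈ (algebraMap (𝓞 k) k).range := by
          have h := conj_mem_range (hx u₀ hu₀)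
          rwa [conj_krForm X.J hJ] at h
        have ha : ((a : 𝓞 k) : k) ∈ (algebraMap (𝓞 k) k).range := ⟨a, rfl⟩
        have hb : conj ℚ k ((b : 𝓞 k) : k) ∈ (algebraMap (𝓞 k) k).range := ⟨sigmaInt k b, rfl⟩
        rw [krForm_add_left, krForm_add_right, krForm_add_right, krForm_smul_right, krForm_smul_left, krForm_smul_left,
          krForm_smul_right]
        exact add_mem (add_mem (hQiso u₀ hu₀ v₀ hv₀) (mul_mem hb h2))
          (add_mem (mul_mem ha (hx v₀ hv₀)) (mul_mem ha (mul_mem hb (hself x hxL'))))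
    have hQ'eq : Q ⊔ (𝓞 k) ∙ x₁ = Q := by
      by_contra hne
      exact hQmax _ hmem (lt_of_le_of_ne le_sup_left (Ne.symm hne))
    have hxQ : x₁ ∈ Q := by
      rw [← hQ'eq]
      exact Submodule.mem_sup_right (Submodule.mem_span_singleton_self x₁)
    exact ⟨x₁, hxQ, rfl⟩

end Literature.AlgebraicGeometry.ShimuraVarieties.KudlaRapoport2013.Sec13LevelStructures

end
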